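import Summits.CriticalPhenomena.Ising3D.TaylorKernelRegionCheck
import Mathlib.Tactic.Linarith
import Mathlib.Tactic.Positivity
import Mathlib.Tactic.Ring
import HarnessLib

/-!
# The odd-CONE region obligation from a kernel-computable check (symmetrised kernels on the half-strip)
(cell `pub-ising3x`, seat recog-1 gen 11; gate (g2): the `odd_cone` field of `TaylorConeObligations` for a
rational box from `decide`-able data — kernel route, twin of `TaylorKernelRegionCheck`)

HONEST FRAMING: lottery ticket; floor = tightest certified 3D Ising CFT bounds; no exact-solution
claim without a proof.

By `oddCone_half_of_symmKernelCone` the odd cone at all `E ≥ E_T`, integer `j ≤ E` follows from (KM)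
`κ₁|K₃| ≤ K_{ψ,0}` and (KR) `½κ₀κ₂|K₃| + ½κ₀⁻¹κ₃K_{ψ,t} ≤ K₄ - K₅` for the SYMMETRISED kernels on
`{u,v ≥ 0, u+v ≥ E_T}` (`κ₁ = (½)^{Δσ+Δε}`, `κ₂ = (½)^{Δε-Δσ}`, `κ₃ = (½)^{-2Δε}`). Each is two polynomial
positivity statements (`±K₃`) in `(P, θ)` after the substitution of `TaylorKernelRegionCheck`; the scalars
`κ₁, κ₂, κ₃` and the box parameters `Δσ, s̄, Δσ-Δε` enter as `MI` enclosures (hypotheses `∀ p ∈ Q`), the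
majorant `Ψ = Σ_{ab∈lψ} ψ(ab) · taylorCoeffAt ½ ½ ab` by its rational weights. Result:
**`oddCone_of_oddConeRegionCheck`**: `d.check = true →` (∀ p ∈ Q, ∀ E ≥ P₀ + cc, ∀ j ≤ E, `OddConeAt …`), the
shape of `TaylorConeObligations.odd_cone` / `oddConeField_half_of_kernelCone`. SUFFICIENT only. Elementary.
[folklore]
-/

namespace Summit.CriticalPhenomena.Ising3D

open Finset
open Literature.Analysis.ValidatedNumerics Literature.Analysis.ValidatedNumerics.PolyMP
open Literature.Analysis.ValidatedNumerics.NumericsMP (MI)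
open Literature.MathematicalPhysics.QuantumFieldTheory.ConformalBootstrap3D

/-- Row-wise scaling by an interval scalar. [folklore] -/
def smul2MI (S : ℕ) (I : MI) (T : IPoly2) : IPoly2 := T.map (smulI S I)

/-- [folklore] -/
theorem pmem2_smul2MI {S : ℕ} (hS : 0 < S) {x : ℝ} {I : MI} (hx : MI.mem S x I) :
    ∀ {Q : List (List ℝ)} {QI : IPoly2}, PMem2 S Q QI → PMem2 S (smul2 x Q) (smul2MI S I QI)
  | _, _, List.Forall₂.nil => by simpa [smul2, smul2MI] using pmem2_nil S
  | _, _, List.Forall₂.cons (a := q) (b := J) hq hQ => by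
      simp only [smul2, smul2MI, List.map_cons]
      exact List.Forall₂.cons (pmem_smulI hS hx hq) (pmem2_smul2MI hS hx hQ)

/-- Data of an odd-cone region check. [folklore] -/
structure OddConeRegionData where
  /-- fixed-point scale -/
  S : ℕ
  /-- index list and rational weights of the functional (rows 2, 3, 4 used) -/
  l : List (ℕ × ℕ)
  cQ : Fin 5 → ℕ × ℕ → ℚ
  /-- index list and rational weights of the majorant `Ψ` -/
  lψ : List (ℕ × ℕ)
  ψQ : ℕ × ℕ → ℚ
  /-- the cone weight `κ₀ > 0` -/
  κ₀Q : ℚ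
  /-- enclosures of `Δσ`, `(Δσ+Δε)/2`, `Δσ-Δε` and of `κ₁ = (½)^{Δσ+Δε}`, `κ₂ = (½)^{Δε-Δσ}`, `κ₃ = (½)^{-2Δε}` -/
  sσI : MI
  sbI : MI
  stI : MI
  K1 : MI
  K2 : MI
  K3 : MI
  /-- centre, left end (`E_T = P₀ + cc`), row count -/
  ccQ : ℚ
  P0 : ℚ
  N : ℕ
  /-- checker parameters for the four tests -/
  prmM1 : HSParams
  prmM2 : HSParams
  prmR1 : HSParams
  prmR2 : HSParams

namespace OddConeRegionData

/-- The five substituted kernel tables. [folklore] -/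
def T3 (d : OddConeRegionData) : IPoly2 := kernelTableI d.S (d.cQ 2) (-1) d.sbI d.ccQ d.l d.N
/-- [folklore] -/
def T4 (d : OddConeRegionData) : IPoly2 := kernelTableI d.S (d.cQ 3) (-1) d.sσI d.ccQ d.l d.N
/-- [folklore] -/
def T5 (d : OddConeRegionData) : IPoly2 := kernelTableI d.S (d.cQ 4) 1 d.sσI d.ccQ d.l d.N
/-- [folklore] -/
def Tψ0 (d : OddConeRegionData) : IPoly2 := kernelTableI d.S d.ψQ 0 (MI.ofInt d.S 0) d.ccQ d.lψ d.N
/-- [folklore] -/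
def Tψt (d : OddConeRegionData) : IPoly2 := kernelTableI d.S d.ψQ 0 d.stI d.ccQ d.lψ d.N

/-- (KM) with sign `ε`: `K_{ψ,0} - ε κ₁ K₃`. [folklore] -/
def TM (d : OddConeRegionData) (ε : ℤ) : IPoly2 :=
  add2I d.Tψ0 (smul2QI (-(ε : ℚ)) (smul2MI d.S d.K1 d.T3))
/-- (KR) with sign `ε`: `K₄ - K₅ - ε (κ₀/2) κ₂ K₃ - (κ₀⁻¹/2) κ₃ K_{ψ,t}`. [folklore] -/
def TR (d : OddConeRegionData) (ε : ℤ) : IPoly2 :=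
  add2I (add2I d.T4 (neg2I d.T5))
    (add2I (smul2QI (-(ε : ℚ) * (d.κ₀Q / 2)) (smul2MI d.S d.K2 d.T3))
      (smul2QI (-(d.κ₀Q⁻¹ / 2)) (smul2MI d.S d.K3 d.Tψt)))

/-- **The odd-cone region check.** [folklore] -/
def check (d : OddConeRegionData) : Bool :=
  decide (0 < d.S) && decide (0 < d.κ₀Q) &&
  kernelSizeOK d.S (d.cQ 2) (-1) d.sbI d.ccQ d.l d.N && kernelSizeOK d.S (d.cQ 3) (-1) d.sσI d.ccQ d.l d.N &&
  kernelSizeOK d.S (d.cQ 4) 1 d.sσI d.ccQ d.l d.N && kernelSizeOK d.S d.ψQ 0 (MI.ofInt d.S 0) d.ccQ d.lψ d.N &&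
  kernelSizeOK d.S d.ψQ 0 d.stI d.ccQ d.lψ d.N &&
  decide (1 ≤ d.prmM1.θhi) && decide (1 ≤ d.prmM2.θhi) && decide (1 ≤ d.prmR1.θhi) && decide (1 ≤ d.prmR2.θhi) &&
  halfStripPos d.S (d.TM 1) d.P0 d.prmM1 && halfStripPos d.S (d.TM (-1)) d.P0 d.prmM2 &&
  halfStripPos d.S (d.TR 1) d.P0 d.prmR1 && halfStripPos d.S (d.TR (-1)) d.P0 d.prmR2

end OddConeRegionData

/-- **The odd-cone region obligation from the check** (the shape of `TaylorConeObligations.odd_cone` with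
`E_T = P₀ + cc`, `κ₀ = κ₀Q`). [folklore] -/
theorem oddCone_of_oddConeRegionCheck (d : OddConeRegionData) (hl : d.l.Nodup) (hlψ : d.lψ.Nodup)
    (Q : Set (ℝ × ℝ))
    (hQ : ∀ p ∈ Q, MI.mem d.S p.1 d.sσI ∧ MI.mem d.S ((p.1 + p.2) / 2) d.sbI ∧ MI.mem d.S (p.1 - p.2) d.stI ∧
      MI.mem d.S ((1 / 2 : ℝ) ^ (p.1 + p.2)) d.K1 ∧ MI.mem d.S ((1 / 2 : ℝ) ^ (p.2 - p.1)) d.K2 ∧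
      MI.mem d.S ((1 / 2 : ℝ) ^ (-(2 * p.2))) d.K3)
    (h : d.check = true) :
    ∀ p ∈ Q, ∀ (E : ℝ) (j : ℕ), (d.P0 : ℝ) + d.ccQ ≤ E → (j : ℝ) ≤ E →
      OddConeAt (taylorCrossing (1 / 2) (1 / 2) d.l.toFinset fun i ab => (d.cQ i ab : ℝ))
        (∑ ab ∈ d.lψ.toFinset, (d.ψQ ab : ℝ) • taylorCoeffAt (1 / 2) (1 / 2) ab) (d.κ₀Q : ℝ) p.1 p.2 E j := by
  simp only [OddConeRegionData.check, Bool.and_eq_true, decide_eq_true_eq] at h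
  obtain ⟨⟨⟨⟨⟨⟨⟨⟨⟨⟨⟨⟨⟨⟨hS, hκ₀⟩, hN3⟩, hN4⟩, hN5⟩, hNψ0⟩, hNψt⟩, hθ1⟩, hθ2⟩, hθ3⟩, hθ4⟩, hM1⟩, hM2⟩, hR1⟩, hR2⟩ := h
  intro p hp
  obtain ⟨hsσ, hsb, hst, hK1, hK2, hK3⟩ := hQ p hp
  have hκ₀R : (0 : ℝ) ≤ (d.κ₀Q : ℝ) := by exact_mod_cast hκ₀.le
  refine oddCone_half_of_symmKernelCone _ _ _ _ hκ₀R p.1 p.2 ((d.P0 : ℝ) + d.ccQ) fun u v hu hv hE => ?_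
  have hθ := thetaOf_mem hu hv
  have hP : ((d.P0 : ℚ) : ℝ) ≤ u + v - d.ccQ := by linarith
  have h0mem : MI.mem d.S (0 : ℝ) (MI.ofInt d.S 0) := by simpa using MI.mem_ofInt d.S 0
  -- the five kernels through their tables
  have e3 := evenKernelSymm_eq_eval2_kernelTable hS (d.cQ 2) (-1) hsb d.ccQ hl hN3 hu hv
  have e4 := evenKernelSymm_eq_eval2_kernelTable hS (d.cQ 3) (-1) hsσ d.ccQ hl hN4 hu hv
  have e5 := evenKernelSymm_eq_eval2_kernelTable hS (d.cQ 4) 1 hsσ d.ccQ hl hN5 hu hv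
  have eψ0 := evenKernelSymm_eq_eval2_kernelTable hS d.ψQ 0 h0mem d.ccQ hlψ hNψ0 hu hv
  have eψt := evenKernelSymm_eq_eval2_kernelTable hS d.ψQ 0 hst d.ccQ hlψ hNψt hu hv
  have p3 := pmem2_kernelTableI hS (d.cQ 2) (-1) hsb d.ccQ d.l d.N
  have p4 := pmem2_kernelTableI hS (d.cQ 3) (-1) hsσ d.ccQ d.l d.N
  have p5 := pmem2_kernelTableI hS (d.cQ 4) 1 hsσ d.ccQ d.l d.N
  have pψ0 := pmem2_kernelTableI hS d.ψQ 0 h0mem d.ccQ d.lψ d.N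
  have pψt := pmem2_kernelTableI hS d.ψQ 0 hst d.ccQ d.lψ d.N
  -- the four combinations and their positivity
  have pM : ∀ ε : ℤ, PMem2 d.S (add2 (kernelTable d.ψQ 0 0 d.ccQ d.lψ d.N)
      (smul2 (-(ε : ℝ)) (smul2 ((1 / 2 : ℝ) ^ (p.1 + p.2)) (kernelTable (d.cQ 2) (-1) ((p.1 + p.2) / 2) d.ccQ d.l d.N))))
      (d.TM ε) := fun ε =>
    pmem2_add2I pψ0 (pmem2_smul2QI _ (by push_cast; ring) (pmem2_smul2MI hS hK1 p3))
  have pR : ∀ ε : ℤ, PMem2 d.S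
      (add2 (add2 (kernelTable (d.cQ 3) (-1) p.1 d.ccQ d.l d.N) (smul2 (-1) (kernelTable (d.cQ 4) 1 p.1 d.ccQ d.l d.N)))
        (add2 (smul2 (-(ε : ℝ) * ((d.κ₀Q : ℝ) / 2))
            (smul2 ((1 / 2 : ℝ) ^ (p.2 - p.1)) (kernelTable (d.cQ 2) (-1) ((p.1 + p.2) / 2) d.ccQ d.l d.N)))
          (smul2 (-((d.κ₀Q : ℝ)⁻¹ / 2))
            (smul2 ((1 / 2 : ℝ) ^ (-(2 * p.2))) (kernelTable d.ψQ 0 (p.1 - p.2) d.ccQ d.lψ d.N)))))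
      (d.TR ε) := fun ε =>
    pmem2_add2I (pmem2_add2I p4 (pmem2_neg2I p5))
      (pmem2_add2I (pmem2_smul2QI _ (by push_cast; ring) (pmem2_smul2MI hS hK2 p3))
        (pmem2_smul2QI _ (by push_cast; ring) (pmem2_smul2MI hS hK3 pψt)))
  have vM1 := halfStripPos_sound hS (pM 1) hM1 hP hθ.1 (hθ.2.trans (by exact_mod_cast hθ1))
  have vM2 := halfStripPos_sound hS (pM (-1)) hM2 hP hθ.1 (hθ.2.trans (by exact_mod_cast hθ2))
  have vR1 := halfStripPos_sound hS (pR 1) hR1 hP hθ.1 (hθ.2.trans (by exact_mod_cast hθ3))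
  have vR2 := halfStripPos_sound hS (pR (-1)) hR2 hP hθ.1 (hθ.2.trans (by exact_mod_cast hθ4))
  simp only [eval2_add2, eval2_smul2, Int.cast_one, Int.cast_neg] at vM1 vM2 vR1 vR2
  simp only [Rat.cast_neg, Rat.cast_one, Rat.cast_zero] at e3 e4 e5 eψ0 eψt
  rw [← e3, ← eψ0] at vM1 vM2
  rw [← e3, ← e4, ← e5, ← eψt] at vR1 vR2
  have hκ₁ : 0 ≤ (1 / 2 : ℝ) ^ (p.1 + p.2) := (Real.rpow_pos_of_pos (by norm_num) _).le
  have hκ₂ : 0 ≤ (1 / 2 : ℝ) ^ (p.2 - p.1) := (Real.rpow_pos_of_pos (by norm_num) _).le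
  refine ⟨?_, ?_⟩
  · -- (KM): `κ₁ |K₃| ≤ K_{ψ,0}` from the two signs
    rw [← abs_of_nonneg hκ₁, ← abs_mul, abs_le]
    constructor <;> linarith
  · -- (KR)
    have hc : 0 ≤ (d.κ₀Q : ℝ) / 2 * (1 / 2 : ℝ) ^ (p.2 - p.1) := by positivity
    rcases le_total 0 (evenKernelSymm (fun ab => (d.cQ 2 ab : ℝ)) d.l.toFinset ((p.1 + p.2) / 2) (-1) u v)
      with h3 | h3
    · rw [abs_of_nonneg h3]; linarith
    · rw [abs_of_nonpos h3]
      have := mul_nonneg hc (neg_nonneg.mpr h3)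
      nlinarith

/-- The same with the threshold read as the cast of ONE rational `E_T = P₀ + cc` (the form boot-1's `TaylorTable`
instantiates: `T.E_T := d.P0 + d.ccQ`, `T.κ₀ := d.κ₀Q`). [folklore] -/
theorem oddCone_of_oddConeRegionCheck_rat (d : OddConeRegionData) (hl : d.l.Nodup) (hlψ : d.lψ.Nodup)
    (Q : Set (ℝ × ℝ))
    (hQ : ∀ p ∈ Q, MI.mem d.S p.1 d.sσI ∧ MI.mem d.S ((p.1 + p.2) / 2) d.sbI ∧ MI.mem d.S (p.1 - p.2) d.stI ∧
      MI.mem d.S ((1 / 2 : ℝ) ^ (p.1 + p.2)) d.K1 ∧ MI.mem d.S ((1 / 2 : ℝ) ^ (p.2 - p.1)) d.K2 ∧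
      MI.mem d.S ((1 / 2 : ℝ) ^ (-(2 * p.2))) d.K3)
    (h : d.check = true) :
    ∀ p ∈ Q, ∀ (E : ℝ) (j : ℕ), ((d.P0 + d.ccQ : ℚ) : ℝ) ≤ E → (j : ℝ) ≤ E →
      OddConeAt (taylorCrossing (1 / 2) (1 / 2) d.l.toFinset fun i ab => (d.cQ i ab : ℝ))
        (∑ ab ∈ d.lψ.toFinset, (d.ψQ ab : ℝ) • taylorCoeffAt (1 / 2) (1 / 2) ab) (d.κ₀Q : ℝ) p.1 p.2 E j := by
  intro p hp E j hE hj
  rw [Rat.cast_add] at hE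
  exact oddCone_of_oddConeRegionCheck d hl hlψ Q hQ h p hp E j hE hj

end Summit.CriticalPhenomena.Ising3D
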